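import Literature.AlgebraicGeometry.HodgeTheory.DirectImageEndomorphismDet
import Literature.AlgebraicGeometry.HodgeTheory.GlobalInvariantCyclesSectionsProofs
import HarnessLib

/-!
# Continuous Weil sections from special-unitary monodromy

Family `hodge`, layer `Literature/AlgebraicGeometry/HodgeTheory`. The packaging of
`DirectImageEndomorphismDet` (unimodular monodromy on a `g^*`-eigenspace `V_μ ⊆ H¹(X_s)` fixes the
line `Span(⌣ᵈ V_μ)`) with Voisin II Lemma 4.17 on real carriers
(`exists_continuous_section_of_forall_transportFun_eq`, `GlobalInvariantCyclesSectionsProofs`: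
invariant classes extend to continuous sections of the espace étalé `FiberClass π d` of
`Rᵈ π_* ℂ`): for a family `π : 𝒳 ⟶ S` with an endomorphism `g` over `S` whose monodromy at `s₁`
has determinant `1` on the two eigenspaces `V_μ(s₁)`, `V_ν(s₁)` of `g_{s₁}^*` on `H¹` (bases of `d`
elements), EVERY class of `Span(⌣ᵈ V_μ(s₁)) ⊔ Span(⌣ᵈ V_ν(s₁))` extends to a continuous section
through it (`exists_continuous_section_of_det_restrict_eq_one`). For Deligne's abelian scheme with
`K = ℚ(√-p)`-action over `Γ\X⁺`, `Γ ⊂ SU(Λ, H)` ([Deligne1982HodgeCycles, proof of Thm. 4.8,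
p. 50]; [vanGeemen1994HodgeAV, 5.8–5.11]), this is the continuous-section clause of the named fact
`HodgeTheory.deligne1982_weilFamily_globalAction` (`WeilFamilyGlobalAction`), reduced to the
statement "the monodromy on `H¹` is special unitary". No definition, no named fact.

## References

* [Deligne1982HodgeCycles] P. Deligne (notes by J. S. Milne), Hodge cycles on abelian varieties,
  LNM 900 (1982), proof of Thm. 4.8, p. 50.
* [vanGeemen1994HodgeAV] B. van Geemen, An introduction to the Hodge conjecture for abelian
  varieties, LNM 1594 (1994), 5.8–5.11.
* [VoisinHodgeII2003] C. Voisin, Hodge Theory and Complex Algebraic Geometry II, CUP 2003, Lemma 4.17.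
-/

noncomputable section

open CategoryTheory AlgebraicGeometry
open Literature.AlgebraicTopology.SingularHomology

namespace Literature.AlgebraicGeometry.HodgeTheory

section HodgeTheory

variable {𝒳 S : Motives.SchemeOver ℂ} (π : 𝒳 ⟶ S)

/-- **Special-unitary monodromy on `H¹` makes the Weil plane flat: continuous sections through
every class of `Span(⌣ᵈ V_μ(s₁)) ⊔ Span(⌣ᵈ V_ν(s₁))`.** Let `Rᵈ π_* ℂ` be a local system on the
path-connected, locally path-connected `S(ℂ)` (`IsCohomologicallyLocallyTrivialOn π univ`), `g` an
endomorphism of `𝒳` over `S` with fibre maps `g_t`, and suppose that for every loop `γ` at `s₁` the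
transport `γ_*` on `H¹(X_{s₁})` has determinant `1` on the eigenspaces `V_μ(s₁)` and `V_ν(s₁)` of
`g_{s₁}^*` (each with a basis of `d` elements). Then every class `α` of
`Span(⌣ᵈ V_μ(s₁)) ⊔ Span(⌣ᵈ V_ν(s₁))` is monodromy invariant
(`transportFun_eq_self_of_det_restrict_eq_one_sup`) and so extends to a continuous section `σ` of
`FiberClass.pt` with `σ(s₁) = (s₁, α)` (Voisin II, Lemma 4.17). [cite: Deligne1982HodgeCycles, proof of Thm. 4.8, p. 50]
[cite: vanGeemen1994HodgeAV, 5.8–5.11] [cite: VoisinHodgeII2003, Lemma 4.17] -/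
theorem exists_continuous_section_of_det_restrict_eq_one
    (hU : IsCohomologicallyLocallyTrivialOn π (Set.univ : Set (Motives.ComplexPoints S)))
    [PathConnectedSpace (Motives.ComplexPoints S)]
    [LocallyPathConnectedSpace (Motives.ComplexPoints S)]
    (g : 𝒳 ⟶ 𝒳) (hg : g ≫ π = π)
    (gf : ∀ t : Motives.ComplexPoints S, Motives.fiberOver π t ⟶ Motives.fiberOver π t)
    (hgf : ∀ t, gf t ≫ Motives.fiberι π t = Motives.fiberι π t ≫ g)
    (s₁ : Motives.ComplexPoints S) (μ ν : ℂ) {d : ℕ}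
    (bμ : Module.Basis (Fin d) ℂ (Module.End.eigenspace (complexBetti.map (gf s₁) 1).hom μ))
    (bν : Module.Basis (Fin d) ℂ (Module.End.eigenspace (complexBetti.map (gf s₁) 1).hom ν))
    (hdet : ∀ γ : Path.Homotopic.Quotient
        (⟨s₁, Set.mem_univ s₁⟩ : (Set.univ : Set (Motives.ComplexPoints S))) ⟨s₁, Set.mem_univ s₁⟩,
      LinearMap.det ((transportLinear π 1 hU γ).restrict
          (p := Module.End.eigenspace (complexBetti.map (gf s₁) 1).hom μ)
          (q := Module.End.eigenspace (complexBetti.map (gf s₁) 1).hom μ)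
          (fun _ hv ↦ transportFun_mem_eigenspace_fiberHom π 1 hU g hg gf hgf γ hv)) = 1 ∧
      LinearMap.det ((transportLinear π 1 hU γ).restrict
          (p := Module.End.eigenspace (complexBetti.map (gf s₁) 1).hom ν)
          (q := Module.End.eigenspace (complexBetti.map (gf s₁) 1).hom ν)
          (fun _ hv ↦ transportFun_mem_eigenspace_fiberHom π 1 hU g hg gf hgf γ hv)) = 1)
    {α : complexBetti (Motives.fiberOver π s₁) d}
    (hα : α ∈ Submodule.span ℂ
        {x | ∃ w : Fin d → complexBetti (Motives.fiberOver π s₁) 1,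
          (∀ i, w i ∈ Module.End.eigenspace (complexBetti.map (gf s₁) 1).hom μ) ∧
          cupPowOne ℂ (Motives.ComplexPoints (Motives.fiberOver π s₁)) d w = x} ⊔
      Submodule.span ℂ
        {x | ∃ w : Fin d → complexBetti (Motives.fiberOver π s₁) 1,
          (∀ i, w i ∈ Module.End.eigenspace (complexBetti.map (gf s₁) 1).hom ν) ∧
          cupPowOne ℂ (Motives.ComplexPoints (Motives.fiberOver π s₁)) d w = x}) :
    ∃ σ : Motives.ComplexPoints S → FiberClass π d,
      Continuous σ ∧ (∀ s, (σ s).pt = s) ∧ σ s₁ = ⟨s₁, α⟩ :=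
  exists_continuous_section_of_forall_transportFun_eq π d hU s₁ α fun γ ↦
    transportFun_eq_self_of_det_restrict_eq_one_sup π hU g hg gf hgf
      (s := ⟨s₁, Set.mem_univ s₁⟩) γ μ ν bμ bν (hdet γ).1 (hdet γ).2 hα

end HodgeTheory

end Literature.AlgebraicGeometry.HodgeTheory

end
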